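import Summits.FinalStateConjecture.FinalStateConjecture.Theorems.BartnikGapSettlingGapExhaustionIKLocalStepTOfConstants
import Summits.FinalStateConjecture.FinalStateConjecture.Theorems.BartnikGapSettlingGapExhaustionConditionalMultiplierUniform
import Summits.FinalStateConjecture.FinalStateConjecture.Theorems.BartnikGapSettlingGapExhaustionKerrBandHigherRegularityUniform
import Summits.FinalStateConjecture.FinalStateConjecture.Theorems.BartnikGapSettlingGapExhaustionIKStepFrameUniform
import HarnessLib

/-!
# Crux `GapExhaustion` (stmt-FinalStateConjecture-10808), line `photon-shell-pseudoconvexity`: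
# stub (UN-6T) `stub_ikLocalStepTU` — the local step of the `T`-CONDITIONAL sweep in a stationary
# chart, UNIFORMLY over a compact set of subextremal labels

Route `BartnikGapSettling`; helper (`--supports stmt-FinalStateConjecture-10808`) of line lead
c12 (wave 2, S6b‴ chain: the conditional extension of the Hawking field in a stationary
near-Kerr chart sweeps a Killing field through the Kerr–Schild cylinders with a LABEL-UNIFORM
local step). The conditional twin of `stub_ikLocalStepU` (UN-6): the registered conditional sweep
quantifies its tolerance `δ` and the radii `ρ ↦ ρ'` BEFORE the Kerr label `(M, a)`; the landed
constants-first conditional step `ikLocalStepT_of_constants` (V-6T,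
`BartnikGapSettlingGapExhaustionIKLocalStepTOfConstants.lean`) gives `ρ'` depending only on
`(ρ₀, L₃, CK, ε₁, ν, ρ)` and the tolerance `min 1 (min δU δF)` depending only on `(δU, δF)`. This
file makes both UNIFORM over any compact `K ⊆ {0 < M, |a| < M}` of labels with band radii `r_lo`,
`r_e` continuous on `K`, `r₊(ℓ) < r_lo(ℓ) < r_e(ℓ)` (NO photon-shell restriction: the
`T`-conditional multiplier form holds on every band beyond the horizon), by composing

* (V-6T) `ikLocalStepT_of_constants` — the per-label conditional step with the constants
  quantified first and the three brick conclusions as hypotheses;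
* (UU-T) `stub_kerrConditionalMultiplierU` — ONE `(δU, ε₁)` for the `T`-conditional multiplier
  form over `K`;
* (UN-2) `stub_kerrBandHigherRegularityU` at order `6` — ONE `(ρ₀, L₃, ν, CK)` over `K`;
* (UN-6a) `stub_ikFrameNormalisationU` — ONE exact-frame tolerance `δF` (label-free).

Ionescu–Klainerman's `T`-conditional local extension theorem (Surveys Diff. Geom. 20 (2015),
Thm 2.4 with Def. 2.2 / Lemma 2.17, chart form, constant conditioning field `τ`) is the explicit
hypothesis `hIKC`, verbatim the crux skeleton's `IKConditionalLocalKillingExtension`.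
-/

noncomputable section

set_option maxSynthPendingDepth 3

-- D-0017: single-problem summit, `Summit.<S>.<S>.…` by design (cf. lakefile `weak.linter.dupNamespace`).
set_option linter.dupNamespace false

namespace Summit.FinalStateConjecture.FinalStateConjecture.Theorems

open Set Function Metric
open Literature.Geometry.Lorentzian Literature.Geometry.Lorentzian.MetricCoord
open scoped Manifold ContDiff Topology ENNReal

/-- **Stub (UN-6T) of line `photon-shell-pseudoconvexity`, crux `GapExhaustion` — the local step
of the `T`-conditional sweep in a stationary chart, UNIFORMLY over a compact set of labels, from
Ionescu–Klainerman's `T`-conditional local extension theorem (chart form with a constant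
conditioning field, the hypothesis `hIKC`).** For a compact `K ⊆ {(M, a) | 0 < M, |a| < M}` and
band radii `r_lo`, `r_e` continuous on `K` with `r₊(ℓ) < r_lo(ℓ) < r_e(ℓ)` there is ONE
tolerance `δ > 0`, and for every input radius `ρ > 0` ONE output radius `ρ' > 0`, such that for
every label `ℓ ∈ K`, every Ricci-flat spacetime `𝓢` and every chart `Φ : E4 → 𝓢` smooth and
openly embedded on the star domain `{r > ℓ.1}` with injective differential, whose components are
`δ`-close to `g_ℓ` in `C⁶` on the tube `{(r₊ + r_lo)/2 ≤ r ≤ r_e + 1}` and STATIONARY there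
(`Φ^*g (z + t ∂₀) = Φ^*g (z)`), every `C^∞` solution of the coordinate Killing equation on
`ball x ρ ∩ {r < c}` (`r x = c ∈ [r_lo ℓ, r_e ℓ]`) commuting with `∂₀` there extends to one on
`ball x ρ'`, commuting with `∂₀` and agreeing below the cylinder. Composition of (V-6T), (UU-T),
(UN-2), (UN-6a). [cite: IonescuKlainerman2015, Thm 2.4, Def. 2.2, Lemma 2.17] -/
theorem stub_ikLocalStepTU :
    (∀ (A A₁ δ₀ : ℝ), 1 ≤ A → A ≤ A₁ → 0 < δ₀ → δ₀ ≤ 1 → ∃ δ₁ : ℝ, 0 < δ₁ ∧ δ₁ ≤ δ₀ ∧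
      ∀ (G : E4 → E4 →L[ℝ] E4 →L[ℝ] ℝ) (f : E4 → ℝ) (p τ : E4) (Z : E4 → E4),
        IsMetricOn G (ball p 1) →
        (∀ x ∈ ball p 1, ricAt G x = 0) →
        G p = Minkowski.bilin →
        ContDiffOn ℝ ∞ f (ball p 1) →
        (∀ x ∈ ball p 1,
          (∑ j ∈ Finset.Icc 1 6, ‖iteratedFDeriv ℝ j G x‖) +
            (∑ j ∈ Finset.Icc 1 4, ‖iteratedFDeriv ℝ j f x‖) ≤ A) →
        f p = 0 → A₁⁻¹ ≤ ‖fderiv ℝ f p‖ →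
        A₁⁻¹ ≤ ‖τ‖ → ‖τ‖ ≤ A₁ →
        (∀ x ∈ ball p 1, fderiv ℝ G x τ = 0) →
        (∀ x ∈ ball p 1, fderiv ℝ f x τ = 0) →
        (∃ μ ∈ Icc (-A₁) A₁, ∀ X : E4,
          A₁⁻¹ * ‖X‖ ^ 2 ≤ μ * G p X X - hessAt G f p X X +
            A₁ * ((fderiv ℝ f p X) ^ 2 + (G p τ X) ^ 2)) →
        ContDiffOn ℝ ∞ Z (ball p δ₀ ∩ {x | f x < 0}) →
        (∀ x ∈ ball p δ₀ ∩ {x | f x < 0}, ∀ Y W : E4,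
          fderiv ℝ G x (Z x) Y W + G x (fderiv ℝ Z x Y) W + G x Y (fderiv ℝ Z x W) = 0) →
        (∀ x ∈ ball p δ₀ ∩ {x | f x < 0}, fderiv ℝ Z x τ = 0) →
        ∃ Z' : E4 → E4, ContDiffOn ℝ ∞ Z' (ball p δ₁) ∧
          (∀ x ∈ ball p δ₁, ∀ Y W : E4,
            fderiv ℝ G x (Z' x) Y W + G x (fderiv ℝ Z' x Y) W + G x Y (fderiv ℝ Z' x W) = 0) ∧
          (∀ x ∈ ball p δ₁, fderiv ℝ Z' x τ = 0) ∧
          EqOn Z' Z (ball p δ₁ ∩ {x | f x < 0})) →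
    ∀ (K : Set (ℝ × ℝ)) (r_lo r_e : ℝ × ℝ → ℝ), IsCompact K →
      (∀ ℓ ∈ K, 0 < ℓ.1 ∧ |ℓ.2| < ℓ.1) → ContinuousOn r_lo K → ContinuousOn r_e K →
      (∀ ℓ ∈ K, Kerr.rPlus ℓ.1 ℓ.2 < r_lo ℓ ∧ r_lo ℓ < r_e ℓ) →
      ∃ δ : ℝ, 0 < δ ∧ ∀ ρ : ℝ, 0 < ρ → ∃ ρ' : ℝ, 0 < ρ' ∧ ∀ ℓ ∈ K,
      ∀ (𝓢 : Spacetime.{0} 4) [𝓢.metric.HasLeviCivita] (Φ : E4 → 𝓢.carrier),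
        𝓢.metric.toPseudoRiemannianMetric.IsRicciFlat →
        ContMDiffOn 𝓘(ℝ, E4) (𝓡 4) ∞ Φ {z | ℓ.1 < Kerr.radius ℓ.2 z} →
        Topology.IsOpenEmbedding ({z : E4 | ℓ.1 < Kerr.radius ℓ.2 z}.restrict Φ) →
        (∀ z : E4, ℓ.1 < Kerr.radius ℓ.2 z → Function.Injective (mfderiv 𝓘(ℝ, E4) (𝓡 4) Φ z)) →
        (∀ z : E4, (Kerr.rPlus ℓ.1 ℓ.2 + r_lo ℓ) / 2 ≤ Kerr.radius ℓ.2 z →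
          Kerr.radius ℓ.2 z ≤ r_e ℓ + 1 → ∀ j : ℕ, j ≤ 6 →
            ‖iteratedFDeriv ℝ j (fun z => 𝓢.metricInCoords Φ z - Kerr.bilin ℓ.1 ℓ.2 z) z‖ ≤ δ) →
        (∀ z : E4, (Kerr.rPlus ℓ.1 ℓ.2 + r_lo ℓ) / 2 ≤ Kerr.radius ℓ.2 z →
          Kerr.radius ℓ.2 z ≤ r_e ℓ + 1 →
          ∀ t : ℝ, 𝓢.metricInCoords Φ (z + t • E4.basisVector 0) = 𝓢.metricInCoords Φ z) →
        ∀ c ∈ Icc (r_lo ℓ) (r_e ℓ), ∀ x : E4, Kerr.radius ℓ.2 x = c → ∀ k : E4 → E4,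
          ContDiffOn ℝ ∞ k (ball x ρ ∩ {y | Kerr.radius ℓ.2 y < c}) →
          (∀ y ∈ ball x ρ ∩ {y | Kerr.radius ℓ.2 y < c}, ∀ Y Z : E4,
            fderiv ℝ (𝓢.metricInCoords Φ) y (k y) Y Z + 𝓢.metricInCoords Φ y (fderiv ℝ k y Y) Z
              + 𝓢.metricInCoords Φ y Y (fderiv ℝ k y Z) = 0) →
          (∀ y ∈ ball x ρ ∩ {y | Kerr.radius ℓ.2 y < c}, fderiv ℝ k y (E4.basisVector 0) = 0) →
          ∃ k' : E4 → E4, ContDiffOn ℝ ∞ k' (ball x ρ') ∧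
            (∀ y ∈ ball x ρ', ∀ Y Z : E4,
              fderiv ℝ (𝓢.metricInCoords Φ) y (k' y) Y Z + 𝓢.metricInCoords Φ y (fderiv ℝ k' y Y) Z
                + 𝓢.metricInCoords Φ y Y (fderiv ℝ k' y Z) = 0) ∧
            (∀ y ∈ ball x ρ', fderiv ℝ k' y (E4.basisVector 0) = 0) ∧
            EqOn k' k (ball x ρ' ∩ {y | Kerr.radius ℓ.2 y < c}) := by
  intro hIKC K r_lo r_e hK hlab hloc hrec hband
  -- (UU-T): ONE `T`-conditional multiplier-form pair `(δU, ε₁)` over `K`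
  obtain ⟨δU, ε₁, hδU, hε₁, hU⟩ := stub_kerrConditionalMultiplierU K r_lo r_e hK hlab hloc hrec hband
  -- (UN-2) at order 6: ONE tube / Lipschitz / `C⁶` constant set `(ρ₀, L₃, ν, CK)` over `K`
  obtain ⟨ρ₀, L₃, ν, CK, hρ₀, hL₃, hν, hCK, hbandU⟩ :=
    stub_kerrBandHigherRegularityU K r_lo r_e 6 hK hlab hloc hrec
      fun ℓ hℓ ↦ ⟨(hband ℓ hℓ).1, (hband ℓ hℓ).2.le⟩
  -- (UN-6a): ONE exact-frame tolerance `δF`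
  obtain ⟨δF, hδF, hF⟩ := stub_ikFrameNormalisationU
  refine ⟨min 1 (min δU δF), lt_min one_pos (lt_min hδU hδF), fun ρ hρ ↦ ?_⟩
  -- (V-6T): the per-label conditional step with these constants
  obtain ⟨ρ', hρ', H⟩ :=
    ikLocalStepT_of_constants hIKC δU ε₁ ρ₀ L₃ ν CK δF hδU hε₁ hρ₀ hL₃ hν hCK hδF ρ hρ
  refine ⟨ρ', hρ', fun ℓ hℓ 𝓢 _ Φ hRF hΦ hemb hinjd hclose hstat ↦ ?_⟩
  exact H ℓ.1 ℓ.2 (r_lo ℓ) (r_e ℓ) (hlab ℓ hℓ).1 (hlab ℓ hℓ).2 (hband ℓ hℓ).1 (hband ℓ hℓ).2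
    (hU ℓ hℓ) (hbandU ℓ hℓ) (hF ℓ.1 ℓ.2 (hlab ℓ hℓ).1) 𝓢 Φ hRF hΦ hemb hinjd hclose hstat

end Summit.FinalStateConjecture.FinalStateConjecture.Theorems

end
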